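import Summits.RiemannHypothesis.RiemannHypothesis.Theorems.ThetaTier1Arith
import Summits.RiemannHypothesis.RiemannHypothesis.Theorems.ThetaTier2Sound
import HarnessLib

/-!
# THETA tier-2 kernel checker — the ROW: atoms, field expressions and the kernel input `mkInp` (cc-s2-1; RH-FREE)

§6(e) of HOME/cc-s2-1/gen22/TIER2-KERNEL-SPEC.md, part 1 of 2.  A tier-2 row is `(q, q⁺, m, δ·10¹², menu, k)` (menu `0` = seed
`(1/20, 19/20, 1)` with `η′ = 1/100`; menu `1` = tier 1's `(1/4, 3/5, 1)` with `η′ = 1/20`); the campaign constants are `K = 6` harmonics,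
`τ = 1/100`, `Jt = 300` (`D = 3`), `Kw = 400` (`W_l = 4`), `J = 64` gain cells (SPEC §4).  This file builds the kernel input `Inp` of
`ThetaTier2Check` FROM THE ROW, in the kernel:

* the thirty transcendental atoms (tier 1's `ThetaTier1.Atom`, enclosed by `NumericsMP.MI` at `2⁶⁴`: `π, log 2, log 4π`, the arch
  exponentials, `e^{±τ…}`, `e^{2δ−η′}, e^{η′−δ}, e^{δ}, e^{t₀/2}, e^{−(m+1)W_l}, e^{−mW_l}, e^{m(2δ−η′)}, e^{2δ}, log q, √q`);
* the composite fields as `RExpr` terms over the atom box (`θ₀, u₁, M₀, M̄, M₁₀, M̄₁, coefA, GtailW, tailInt, C(N), rA, rB, 2 log q/√q`),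
  evaluated by `RExpr.enclose` and rounded OUTWARD to the `2⁹⁶` grid (`upQ`/`dnQ`, `hiOf`/`loOf`);
* the exact rational fields (`c₂, ε`, the ζ-residues from `zetaHi`, the cut values `cutVal`/`cutDerVal` = Irwin–Hall CDF / density values,
  `χ_L`, `ΣΛ ≤ pLamHi`, `δ/J`, the 64 gain pairs from tier 1's `Rtop`), rounded outward;
* `Row2.real` — the REAL closed forms these fields enclose (the `RealAtoms` of `ThetaTier2Sound`), stated for the E-side.

Soundness (`AtomsOK (mkInp r X) r.real` from the enclosures, and `Row2.check_sound`) is part 2 (`ThetaTier2RowSound`).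
Nothing here bears on the truth of RH.
-/

set_option linter.dupNamespace false  -- the mandated namespace repeats `RiemannHypothesis`
set_option autoImplicit false

namespace Summit.RiemannHypothesis.RiemannHypothesis.Theorems.ThetaTier2

open Literature.Analysis.ValidatedNumerics
open ThetaTier1 (Atom IH Rtop zetaHi pLamHi GAMMA_LO PREC HERON rpow)

/-! ## Rows and campaign constants -/

/-- One tier-2 row: prime `q`, next prime `qn`, B-spline order `m`, `δ·10¹²`, menu (`0`: seed `(1/20,19/20,1)`, `η′ = 1/100`;
else seed `(1/4,3/5,1)`, `η′ = 1/20`), arch split `t₀ = 2^{-k}`. [this cell, TIER2-KERNEL-SPEC §4] -/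
structure Row2 where
  /-- the prime -/
  q : ℕ
  /-- the next prime -/
  qn : ℕ
  /-- B-spline order -/
  m : ℕ
  /-- `δ·10¹²` -/
  dnum : ℕ
  /-- menu -/
  menu : ℕ
  /-- `t₀ = 2^{-k}` -/
  k : ℕ

/-- Harmonics kept. [this cell, TIER2-KERNEL-SPEC §4] -/
def KH : ℕ := 6
/-- Cell width `τ = 1/100`. [this cell, TIER2-KERNEL-SPEC §4] -/
def TAU : ℚ := 1 / 100
/-- Depth cells `Jt = D/τ = 300`. [this cell, TIER2-KERNEL-SPEC §4] -/
def JT : ℕ := 300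
/-- Lag cells `Kw = W_l/τ = 400`. [this cell, TIER2-KERNEL-SPEC §4] -/
def KW : ℕ := 400
/-- Depth `D = 3`. [this cell] -/
def DEPTH : ℚ := 3
/-- Lag range `W_l = 4`. [this cell] -/
def WL : ℚ := 4
/-- Gain cells `J = 64`. [this cell] -/
def JG : ℕ := 64

namespace Row2

variable (r : Row2)

/-- `δ`. [this cell] -/
def delta : ℚ := (r.dnum : ℚ) / 1000000000000
/-- `η′`. [this cell] -/
def eta : ℚ := if r.menu = 0 then 1 / 100 else 1 / 20
/-- seed `c₁`. [this cell] -/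
def c1 : ℚ := if r.menu = 0 then 1 / 20 else 1 / 4
/-- seed `m₀`. [this cell] -/
def m0 : ℚ := if r.menu = 0 then 19 / 20 else 3 / 5
/-- seed `c₂ = 1`. [this cell] -/
def c2 (_r : Row2) : ℚ := 1
/-- `ε = 2δc₂`. [this cell] -/
def eps : ℚ := 2 * r.delta * r.c2
/-- `α = (c₂ − ε − m₀)/(m₀ − c₁ − ε)`. [this cell] -/
def alpha : ℚ := (r.c2 - r.eps - r.m0) / (r.m0 - r.c1 - r.eps)
/-- `Σ|c| = 2 + 2α`. [this cell] -/
def csum : ℚ := 2 + 2 * r.alpha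
/-- `h_max = max(1, α)`. [this cell] -/
def hmax : ℚ := max 1 r.alpha
/-- `t₀ = 2^{-k}`. [this cell] -/
def t0 : ℚ := 1 / 2 ^ r.k
/-- `R = ζ(m+1)⁺ − Σ_{k≤K} k^{−(m+1)}`. [this cell] -/
def resid1 : ℚ := zetaHi (r.m + 1) - ((List.range KH).map fun i => (1 : ℚ) / ((i + 1 : ℕ) : ℚ) ^ (r.m + 1)).sum
/-- `Rm = ζ(m)⁺ − Σ_{k≤K} k^{−m}`. [this cell] -/
def resid0 : ℚ := zetaHi r.m - ((List.range KH).map fun i => (1 : ℚ) / ((i + 1 : ℕ) : ℚ) ^ r.m).sum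
/-- `χ_L = F_IH(m; 2mδ/η′)`. [this cell, THETA-CERT-cc6 D4] -/
def chiL : ℚ := IH r.m (2 * r.m * r.delta / r.eta)
/-- `ncut = ⌈η′/τ⌉`. [this cell] -/
def ncut : ℕ := ⌈r.eta / TAU⌉₊
/-- the layer window start `j0 = ⌊(η′ − 2δ)/τ⌋` (`0` if `2δ > η′`). [this cell] -/
def j0 : ℕ := if 2 * r.delta ≤ r.eta then ⌊(r.eta - 2 * r.delta) / TAU⌋₊ else 0
/-- the layer window end `j1p = min(Jt − 1, ⌊η′/τ⌋) + 1` (`0` if `2δ > η′`). [this cell] -/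
def j1p : ℕ := if 2 * r.delta ≤ r.eta then min (JT - 1) ⌊r.eta / TAU⌋₊ + 1 else 0

/-- Partial sum of the Irwin–Hall DENSITY `Σ_{j<k} (−1)^j C(m,j)(s−j)^{m−1}`. [folklore] -/
def ihPdfSum (m : ℕ) (s : ℚ) : ℕ → ℚ
  | 0 => 0
  | j + 1 => ihPdfSum m s j + (-1) ^ j * (Nat.choose m j : ℚ) * (s - j) ^ (m - 1)
/-- The Irwin–Hall density `f_m(s) = (1/(m−1)!) Σ_{j ≤ ⌊s⌋} (−1)^j C(m,j)(s−j)^{m−1}` on `0 < s < m`, else `0`. [folklore] -/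
def ihPdf (m : ℕ) (s : ℚ) : ℚ :=
  if s ≤ 0 then 0 else if (m : ℚ) ≤ s then 0 else ihPdfSum m s (⌊s⌋.toNat + 1) / (Nat.factorial (m - 1) : ℚ)

/-- The cut value of cell `j`: `F_IH(m; m(j+1)τ/η′)` (`1` once `(j+1)τ ≥ η′`) — the supremum of `1 − χ(x₁ − t)` over the cell is the
E-side's reading. [this cell, TIER2-KERNEL-SPEC §1] -/
def cutVal (j : ℕ) : ℚ := if r.eta ≤ (j + 1) * TAU then 1 else IH r.m (r.m * ((j + 1) * TAU) / r.eta)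
/-- The cut-derivative value of cell `j`: `(m/η′)·f_IH(m; m t*/η′)`, `t*` the point of the cell nearest the mode `η′/2` (`0` once `jτ ≥ η′`).
[this cell, TIER2-KERNEL-SPEC §1] -/
def cutDerVal (j : ℕ) : ℚ :=
  if r.eta ≤ j * TAU then 0
  else if j * TAU ≤ r.eta / 2 ∧ r.eta / 2 ≤ (j + 1) * TAU then r.m / r.eta * ihPdf r.m (r.m / 2)
  else
    let tt : ℚ := if (j + 1) * TAU < r.eta / 2 then (j + 1) * TAU else j * TAU
    r.m / r.eta * ihPdf r.m (r.m * tt / r.eta)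
/-- `τ₁`'s lower polynomial `(w − w²/2)/(2δ)`. [this cell, THETA-CERT-cc6 D8] -/
def tau1lo (w : ℚ) : ℚ := (w - w * w / 2) / (2 * r.delta)
/-- Gain profile value `Ra_j = R(τ₁lo(δj/J))`. [this cell, THETA-CERT-cc6 D8] -/
def gainA (j : ℕ) : ℚ := Rtop r.m (r.tau1lo (r.delta * j / JG))
/-- Gain profile value `Rb_j = R(τ₁lo(2δ − δ(j+1)/J))`. [this cell, THETA-CERT-cc6 D8] -/
def gainB (j : ℕ) : ℚ := Rtop r.m (r.tau1lo (2 * r.delta - r.delta * (j + 1) / JG))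

/-! ## The atoms (registers `0 … 29`) -/

/-- The thirty atoms of a row: `0 π · 1 log 2 · 2 log 4π · 3 e^{1/2} · 4–9 e^{−(4j+1)/2} · 10 e^{−25/2} · 11 e^{−2} · 12 e^{τ} · 13 e^{−(m+½)τ} ·
14 e^{−mτ} · 15 e^{−(m−1)τ} · 16 e^{−τ/2} · 17 e^{−(2m+1)D} · 18 e^{−2mD} · 19 e^{−(2m−1)D} · 20 e^{2δ−η′} · 21 e^{η′−δ} · 22 e^{δ} · 23 e^{t₀/2} ·
24 e^{−(m+1)W_l} · 25 e^{−mW_l} · 26 e^{m(2δ−η′)} · 27 e^{2δ} · 28 log q · 29 √q`. [this cell] -/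
def atoms : List Atom :=
  [ .pi, .logTwo, .logFourPi, .exp (1 / 2), .exp (-1 / 2), .exp (-5 / 2), .exp (-9 / 2), .exp (-13 / 2), .exp (-17 / 2),
    .exp (-21 / 2), .exp (-25 / 2), .exp (-2), .exp TAU, .exp (-(r.m + 1 / 2) * TAU), .exp (-(r.m : ℚ) * TAU),
    .exp (-(r.m - 1 : ℚ) * TAU), .exp (-TAU / 2), .exp (-(2 * r.m + 1 : ℚ) * DEPTH), .exp (-(2 * r.m : ℚ) * DEPTH),
    .exp (-(2 * r.m - 1 : ℚ) * DEPTH), .exp (2 * r.delta - r.eta), .exp (r.eta - r.delta), .exp r.delta, .exp (r.t0 / 2),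
    .exp (-(r.m + 1 : ℚ) * WL), .exp (-(r.m : ℚ) * WL), .exp (r.m * (2 * r.delta - r.eta)), .exp (2 * r.delta),
    .logNat r.q, .sqrtNat r.q ]

/-- The real values of the atoms. [this cell] -/
noncomputable def vals : ℕ → ℝ := ThetaTier1.valOf r.atoms

/-! ## The composite fields as `RExpr` terms -/

/-- `ζ* = 4πδq·e^{2δ−η′}`. [this cell] -/
def eZs : RExpr := .mul (.const (4 * r.delta * r.q)) (.mul (.var 0) (.var 20))
/-- `θ₀ = ζ*/m`. [this cell] -/
def eTh0 : RExpr := .mul r.eZs (.const (1 / r.m))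
/-- `(m/ζ*)^m`. [this cell] -/
def eRatM : RExpr := rpow (.mul (.const r.m) (.inv r.eZs)) r.m
/-- `M₀ = (Σ|c|/π)(m/ζ*)^m`. [this cell] -/
def eM0 : RExpr := .mul (.mul (.const r.csum) (.inv (.var 0))) r.eRatM
/-- `M̄ = M₀ζ(m+1)⁺`. [this cell] -/
def eMbar : RExpr := .mul r.eM0 (.const (zetaHi (r.m + 1)))
/-- `u₁ = e^{η′−δ}/√q`. [this cell] -/
def eU1 (_r : Row2) : RExpr := .mul (.var 21) (.inv (.var 29))
/-- `M₁₀ = 2q e^{2δ−η′}Σ|c|/c₂·(m/ζ*)^m`. [this cell] -/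
def eM10 : RExpr := .mul (.mul (.const (2 * r.q * r.csum / r.c2)) (.var 20)) r.eRatM
/-- `M̄₁ = M₁₀·ζ(m)⁺(c₂ + ε(1 + 1/θ₀))`. [this cell] -/
def eMbar1 : RExpr :=
  .mul r.eM10 (.mul (.const (zetaHi r.m)) (.add (.const r.c2) (.mul (.const r.eps) (.add (.const 1) (.inv r.eTh0)))))
/-- `J⁺(t₀) = k log 2 + 1/2 + e^{1/2}/16 + Σ_{j≤5} e^{−(4j+1)/2}·4/(4j+1) + e^{−25/2}(4/25)/(1 − e^{−2})`. [this cell, THETA-CERT-cc6 D7] -/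
def eJ : RExpr :=
  .add (.add (.add (.mul (.const r.k) (.var 1)) (.const (1 / 2))) (.mul (.var 3) (.const (1 / 16))))
    (.add (.add (.add (.add (.add (.add (.mul (.var 4) (.const 4)) (.mul (.var 5) (.const (4 / 5))))
      (.mul (.var 6) (.const (4 / 9)))) (.mul (.var 7) (.const (4 / 13)))) (.mul (.var 8) (.const (4 / 17))))
      (.mul (.var 9) (.const (4 / 21))))
      (.mul (.mul (.var 10) (.const (4 / 25))) (.inv (.sub (.const 1) (.var 11)))))
/-- `coefA = max(0, 2J⁺ − log 4π − γ⁻ − (π/2 + log 2))`. [this cell, THETA-CERT-cc6 D7] -/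
def eCoefA : RExpr :=
  .max (.const 0) (.sub (.sub (.sub (.mul (.const 2) r.eJ) (.var 2)) (.const GAMMA_LO))
    (.add (.mul (.var 0) (.const (1 / 2))) (.var 1)))
/-- `GtailW = ζ(m+1)⁺²·W_l·e^{−(m+1)W_l}`. [this cell] -/
def eGtail : RExpr := .mul (.const (zetaHi (r.m + 1) ^ 2 * WL)) (.var 24)
/-- `tailInt = ζ(m+1)⁺²·e^{−mW_l}(W_l/m + 1/m²)`. [this cell] -/
def eTailInt : RExpr := .mul (.const (zetaHi (r.m + 1) ^ 2 * (WL / r.m + 1 / (r.m : ℚ) ^ 2))) (.var 25)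
/-- `C(N) = 2 log 2 + 2(log q + 2δ − 2η′)·e^{η′−δ}/√q` (`N = q e^{2δ−2η′}`). [this cell, THETA-CERT-cc6 §F (Chebyshev)] -/
def eCpsi : RExpr :=
  .add (.mul (.const 2) (.var 1)) (.mul (.mul (.mul (.const 2) (.add (.var 28) (.const (2 * r.delta - 2 * r.eta)))) (.var 21))
    (.inv (.var 29)))
/-- `rA = 4δe^{δ}h_max`. [this cell] -/
def eRA : RExpr := .mul (.const (4 * r.delta * r.hmax)) (.var 22)
/-- `rB = 2δe^{δ}/√q`. [this cell] -/
def eRB : RExpr := .mul (.mul (.const (2 * r.delta)) (.var 22)) (.inv (.var 29))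
/-- `2 log q/√q`. [this cell] -/
def eRcoef (_r : Row2) : RExpr := .mul (.mul (.const 2) (.var 28)) (.inv (.var 29))

/-- The composite expressions, as a list (all must enclose). [this cell] -/
def exprs : List RExpr :=
  [r.eTh0, r.eM0, r.eMbar, r.eU1, r.eM10, r.eMbar1, r.eCoefA, r.eGtail, r.eTailInt, r.eCpsi, r.eRA, r.eRB, r.eRcoef]

/-! ## Outward rounding to the `2⁹⁶` grid -/

/-- `⌈x·2⁹⁶⌉` as a natural (`0` for `x ≤ 0`). [this cell] -/
def upQ (x : ℚ) : ℕ := ⌈x * (S : ℚ)⌉₊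
/-- `⌊x·2⁹⁶⌋` as a natural (`0` for `x ≤ 0`). [this cell] -/
def dnQ (x : ℚ) : ℕ := ⌊x * (S : ℚ)⌋₊
/-- Upper grid value of an optional interval's upper end (`0` on failure). [this cell] -/
def hiOf (o : Option (NonemptyInterval ℚ)) : ℕ := match o with | some I => upQ I.snd | none => 0
/-- Lower grid value of an optional interval's lower end (`0` on failure). [this cell] -/
def loOf (o : Option (NonemptyInterval ℚ)) : ℕ := match o with | some I => dnQ I.fst | none => 0

/-- Enclose a composite expression on the atom box. [this cell] -/
def enc (e : RExpr) (X : ℕ → NonemptyInterval ℚ) : Option (NonemptyInterval ℚ) := e.enclose PREC HERON X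

/-! ## The kernel input -/

/-- **`mkInp`** — the `Inp` of `ThetaTier2Check` for the row `r`, read off the atom box `X`. [this cell, TIER2-KERNEL-SPEC §1] -/
def mkInp (X : ℕ → NonemptyInterval ℚ) : Inp where
  m := r.m
  K := KH
  Jt := JT
  Kw := KW
  ncut := r.ncut
  j0 := r.j0
  j1p := r.j1p
  piL := dnQ (X 0).fst
  piH := upQ (X 0).snd
  th0L := loOf (enc r.eTh0 X)
  th0H := hiOf (enc r.eTh0 X)
  etL := dnQ (X 12).fst
  etH := upQ (X 12).snd
  emhStep := upQ (X 13).snd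
  emStep := upQ (X 14).snd
  em1Step := upQ (X 15).snd
  ehStep := upQ (X 16).snd
  eD2m1 := upQ (X 17).snd
  eD2m := upQ (X 18).snd
  eD2m_1 := upQ (X 19).snd
  tau := upQ TAU
  M0 := hiOf (enc r.eM0 X)
  Mbar := hiOf (enc r.eMbar X)
  M10 := hiOf (enc r.eM10 X)
  Mbar1 := hiOf (enc r.eMbar1 X)
  u1H := hiOf (enc r.eU1 X)
  zm1H := upQ (zetaHi (r.m + 1))
  residm1 := upQ r.resid1
  residm := upQ r.resid0
  c2 := upQ r.c2
  eps := upQ r.eps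
  cList := (List.range r.ncut).map fun j => upQ (r.cutVal j)
  cpList := (List.range r.ncut).map fun j => upQ (r.cutDerVal j)
  et0half := upQ (X 23).snd
  t0 := upQ r.t0
  coefA := hiOf (enc r.eCoefA X)
  lamSum := upQ (pLamHi (r.m + 1))
  GtailW := hiOf (enc r.eGtail X)
  tailInt := hiOf (enc r.eTailInt X)
  Cpsi := hiOf (enc r.eCpsi X)
  emL := upQ (X 26).snd
  chiL := upQ r.chiL
  rA := hiOf (enc r.eRA X)
  rB := hiOf (enc r.eRB X)
  rcoef := hiOf (enc r.eRcoef X)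
  logqL := dnQ (X 28).fst
  dJ := dnQ (r.delta / JG)
  gainPairs := (List.range JG).map fun j => (dnQ (r.gainA j), dnQ (r.gainB j))

/-! ## The real closed forms the fields enclose -/

/-- `ζ* = 4πδq·e^{2δ−η′}` as a real. [this cell] -/
noncomputable def zsR : ℝ := 4 * (r.delta : ℝ) * r.q * (Real.pi * Real.exp ((2 * r.delta - r.eta : ℚ) : ℝ))
/-- `θ₀` as a real. [this cell] -/
noncomputable def th0R : ℝ := r.zsR * (1 / (r.m : ℝ))
/-- `(m/ζ*)^m` as a real. [this cell] -/
noncomputable def ratMR : ℝ := ((r.m : ℝ) * r.zsR⁻¹) ^ r.m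
/-- `M₀` as a real. [this cell] -/
noncomputable def M0R : ℝ := (r.csum : ℝ) * Real.pi⁻¹ * r.ratMR
/-- `M₁₀` as a real. [this cell] -/
noncomputable def M10R : ℝ := ((2 * r.q * r.csum / r.c2 : ℚ) : ℝ) * Real.exp ((2 * r.delta - r.eta : ℚ) : ℝ) * r.ratMR
/-- `J⁺(t₀)` as a real. [this cell, THETA-CERT-cc6 D7] -/
noncomputable def JR : ℝ :=
  (r.k : ℝ) * Real.log 2 + 1 / 2 + Real.exp ((1 / 2 : ℚ) : ℝ) * (1 / 16)
    + (Real.exp ((-1 / 2 : ℚ) : ℝ) * 4 + Real.exp ((-5 / 2 : ℚ) : ℝ) * (4 / 5) + Real.exp ((-9 / 2 : ℚ) : ℝ) * (4 / 9)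
      + Real.exp ((-13 / 2 : ℚ) : ℝ) * (4 / 13) + Real.exp ((-17 / 2 : ℚ) : ℝ) * (4 / 17) + Real.exp ((-21 / 2 : ℚ) : ℝ) * (4 / 21)
      + Real.exp ((-25 / 2 : ℚ) : ℝ) * (4 / 25) * (1 - Real.exp ((-2 : ℚ) : ℝ))⁻¹)

/-- **The real data of the row** (`RealAtoms` of `ThetaTier2Sound`): true transcendental values where the kernel encloses them,
rational stand-ins (`zetaHi`, `pLamHi`, `GAMMA_LO`, Irwin–Hall values) where an analytic fact links them to `P`. [this cell, TIER2-KERNEL-SPEC §1] -/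
noncomputable def real : RealAtoms where
  τ := TAU
  θ₀ := r.th0R
  M₀ := r.M0R
  M₁₀ := r.M10R
  c₂ := r.c2
  ε := r.eps
  R := r.resid1
  Rm := r.resid0
  u₁ := Real.exp ((r.eta - r.delta : ℚ) : ℝ) * (Real.sqrt r.q)⁻¹
  Mb := r.M0R * (zetaHi (r.m + 1) : ℝ)
  Mb1 := r.M10R * ((zetaHi r.m : ℝ) * ((r.c2 : ℝ) + (r.eps : ℝ) * (1 + r.th0R⁻¹)))
  E1 := Real.exp ((-(2 * r.m + 1 : ℚ) * DEPTH : ℚ) : ℝ)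
  E2 := Real.exp ((-(2 * r.m : ℚ) * DEPTH : ℚ) : ℝ)
  E3 := Real.exp ((-(2 * r.m - 1 : ℚ) * DEPTH : ℚ) : ℝ)
  e0 := Real.exp ((r.t0 / 2 : ℚ) : ℝ)
  t0 := r.t0
  cA := max 0 (2 * r.JR - Real.log (4 * Real.pi) - (GAMMA_LO : ℝ) - (Real.pi * (1 / 2) + Real.log 2))
  Λ := pLamHi (r.m + 1)
  C := 2 * Real.log 2 + 2 * (Real.log r.q + ((2 * r.delta - 2 * r.eta : ℚ) : ℝ)) * Real.exp ((r.eta - r.delta : ℚ) : ℝ)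
    * (Real.sqrt r.q)⁻¹
  T := ((zetaHi (r.m + 1) ^ 2 * (WL / r.m + 1 / (r.m : ℚ) ^ 2) : ℚ) : ℝ) * Real.exp ((-(r.m : ℚ) * WL : ℚ) : ℝ)
  Gt := ((zetaHi (r.m + 1) ^ 2 * WL : ℚ) : ℝ) * Real.exp ((-(r.m + 1 : ℚ) * WL : ℚ) : ℝ)
  z := zetaHi (r.m + 1)
  eml := Real.exp ((r.m * (2 * r.delta - r.eta) : ℚ) : ℝ)
  χ := r.chiL
  ra := ((4 * r.delta * r.hmax : ℚ) : ℝ) * Real.exp ((r.delta : ℚ) : ℝ)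
  rb := ((2 * r.delta : ℚ) : ℝ) * Real.exp ((r.delta : ℚ) : ℝ) * (Real.sqrt r.q)⁻¹
  rc := 2 * Real.log r.q * (Real.sqrt r.q)⁻¹
  L := Real.log r.q
  d := ((r.delta / JG : ℚ) : ℝ)
  Ra := fun j => (r.gainA j : ℝ)
  Rb := fun j => (r.gainB j : ℝ)
  cb := fun j => if j < r.ncut then (r.cutVal j : ℝ) else 1
  cpb := fun j => if j < r.ncut then (r.cutDerVal j : ℝ) else 0

end Row2

end Summit.RiemannHypothesis.RiemannHypothesis.Theorems.ThetaTier2
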